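import Mathlib.Analysis.InnerProductSpace.Laplacian
import Mathlib.Analysis.InnerProductSpace.PiL2
import Mathlib.Analysis.Calculus.Gradient.Basic
import Mathlib.Analysis.Calculus.FDeriv.Mul
import Mathlib.Analysis.Calculus.ContDiff.Operations
import Mathlib.Algebra.MvPolynomial.PDeriv
import Mathlib.RingTheory.MvPolynomial.EulerIdentity
import Mathlib.RingTheory.MvPolynomial.Homogeneous
import HarnessLib

/-!
# HarmonicShellPolynomial — plate P of ROUND-41 «IsotropicBlobPressureLaw» (S-door lane):
# the calculus of polynomial functions on `EuclideanSpace ℝ ι` BY NAME from `MvPolynomial`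

For `P : MvPolynomial ι ℝ` the function `polyFun P x := MvPolynomial.eval (fun i => x i) P` on
`EuclideanSpace ℝ ι`.  Dictionary (everything the shell plates E0/E1/E2/G ask of an explicit polynomial piece):

* `hasFDerivAt_polyFun` / `fderiv_polyFun(_apply)`: `D(polyFun P)(x) v = Σ_i polyFun (∂ᵢP)(x) · vᵢ`;
* `contDiff_polyFun`: polynomial functions are `C^n` for every `n`;
* `gradient_polyFun_apply`, `inner_gradient_polyFun`, `inner_self_gradient_polyFun`: the gradient is
  `(polyFun (∂ᵢP))ᵢ` and `⟪x, ∇(polyFun P)(x)⟫ = polyFun (Σ_i Xᵢ ∂ᵢP)(x)`;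
* `inner_self_gradient_polyFun_of_isHomogeneous`: the EULER IDENTITY `⟪x, ∇h(x)⟫ = l·h(x)` for `P`
  homogeneous of degree `l` (Mathlib's `MvPolynomial.IsHomogeneous.sum_X_mul_pderiv`);
* `fderiv_fderiv_polyFun_apply`, `laplacian_polyFun`: `Δ(polyFun P)(x) = polyFun (Σ_i ∂ᵢ∂ᵢP)(x)`, and
  `laplacian_polyFun_eq_zero` (harmonicity from the algebraic identity `Σ_i ∂ᵢ∂ᵢP = 0`).

So the analytic hypotheses of the ROUND-41 plates on explicit pieces reduce to `MvPolynomial` identities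
(`simp [pderiv_mul, pderiv_X, …]; ring`).  Generic; `--supports stmt-NavierStokesRegularity-0056 --as helper`.
HONEST FRAME: elementary calculus dictionary; nothing about item 0056 `NoTypeII` or NS regularity is proved.
-/

set_option linter.dupNamespace false

open Set Function MvPolynomial InnerProductSpace
open scoped RealInnerProductSpace Laplacian ContDiff

namespace Summit.NavierStokesRegularity.NavierStokesRegularity.Theorems.StrainDoors

namespace HarmonicShell

noncomputable section

variable {ι : Type*}

/-- support (definition): the polynomial FUNCTION on `EuclideanSpace ℝ ι` of `P : MvPolynomial ι ℝ`,
`x ↦ P(x₀, x₁, …)`. -/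
def polyFun (P : MvPolynomial ι ℝ) : EuclideanSpace ℝ ι → ℝ := fun x => MvPolynomial.eval (fun i => x i) P

/-- Unfolding lemma. -/
theorem polyFun_apply (P : MvPolynomial ι ℝ) (x : EuclideanSpace ℝ ι) :
    polyFun P x = MvPolynomial.eval (fun i => x i) P := rfl

/-- `polyFun (C a) = a`. -/
@[simp] theorem polyFun_C (a : ℝ) (x : EuclideanSpace ℝ ι) : polyFun (C a : MvPolynomial ι ℝ) x = a := by
  simp [polyFun]

/-- `polyFun 1 = 1`. -/
@[simp] theorem polyFun_one (x : EuclideanSpace ℝ ι) : polyFun (1 : MvPolynomial ι ℝ) x = 1 := by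
  simp [polyFun]

/-- `polyFun (X i) x = xᵢ`. -/
@[simp] theorem polyFun_X (i : ι) (x : EuclideanSpace ℝ ι) : polyFun (X i : MvPolynomial ι ℝ) x = x i := by
  simp [polyFun]

/-- `polyFun` is additive. -/
@[simp] theorem polyFun_add (P Q : MvPolynomial ι ℝ) (x : EuclideanSpace ℝ ι) :
    polyFun (P + Q) x = polyFun P x + polyFun Q x := by
  simp [polyFun]

/-- `polyFun` is multiplicative. -/
@[simp] theorem polyFun_mul (P Q : MvPolynomial ι ℝ) (x : EuclideanSpace ℝ ι) :
    polyFun (P * Q) x = polyFun P x * polyFun Q x := by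
  simp [polyFun]

/-- `polyFun` of a negation. -/
@[simp] theorem polyFun_neg (P : MvPolynomial ι ℝ) (x : EuclideanSpace ℝ ι) :
    polyFun (-P) x = -polyFun P x := by
  simp [polyFun]

/-- `polyFun` of a difference. -/
@[simp] theorem polyFun_sub (P Q : MvPolynomial ι ℝ) (x : EuclideanSpace ℝ ι) :
    polyFun (P - Q) x = polyFun P x - polyFun Q x := by
  simp [polyFun]

/-- `polyFun` of a power. -/
@[simp] theorem polyFun_pow (P : MvPolynomial ι ℝ) (n : ℕ) (x : EuclideanSpace ℝ ι) :
    polyFun (P ^ n) x = polyFun P x ^ n := by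
  simp [polyFun]

/-- `polyFun` of a natural multiple. -/
@[simp] theorem polyFun_nsmul (P : MvPolynomial ι ℝ) (n : ℕ) (x : EuclideanSpace ℝ ι) :
    polyFun (n • P) x = n * polyFun P x := by
  simp [polyFun]

/-- `polyFun` of a scalar multiple. -/
@[simp] theorem polyFun_smul (P : MvPolynomial ι ℝ) (a : ℝ) (x : EuclideanSpace ℝ ι) :
    polyFun (a • P) x = a * polyFun P x := by
  simp [polyFun, smul_eval]

/-- `polyFun` of a finite sum. -/
@[simp] theorem polyFun_sum {κ : Type*} (s : Finset κ) (P : κ → MvPolynomial ι ℝ) (x : EuclideanSpace ℝ ι) :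
    polyFun (∑ k ∈ s, P k) x = ∑ k ∈ s, polyFun (P k) x := by
  simp [polyFun, map_sum]

/-- `polyFun 0 = 0`. -/
@[simp] theorem polyFun_zero (x : EuclideanSpace ℝ ι) : polyFun (0 : MvPolynomial ι ℝ) x = 0 := by
  simp [polyFun]

variable [Fintype ι] [DecidableEq ι]

/-- **(P1) The derivative of a polynomial function**: `D(polyFun P)(x) = Σ_i polyFun (∂ᵢP)(x) · projᵢ`. -/
theorem hasFDerivAt_polyFun (P : MvPolynomial ι ℝ) (x : EuclideanSpace ℝ ι) :
    HasFDerivAt (polyFun P) (∑ i, polyFun (pderiv i P) x • EuclideanSpace.proj (𝕜 := ℝ) i) x := by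
  induction P using MvPolynomial.induction_on with
  | C a =>
    have h : (∑ i, polyFun (pderiv i (C a : MvPolynomial ι ℝ)) x • EuclideanSpace.proj (𝕜 := ℝ) i) =
        (0 : EuclideanSpace ℝ ι →L[ℝ] ℝ) := by
      simp
    rw [h]
    have : polyFun (C a : MvPolynomial ι ℝ) = fun _ => a := funext fun y => polyFun_C a y
    rw [this]
    exact hasFDerivAt_const a x
  | add p q hp hq =>
    have h : (∑ i, polyFun (pderiv i (p + q)) x • EuclideanSpace.proj (𝕜 := ℝ) i) =
        (∑ i, polyFun (pderiv i p) x • EuclideanSpace.proj (𝕜 := ℝ) i) +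
          ∑ i, polyFun (pderiv i q) x • EuclideanSpace.proj (𝕜 := ℝ) i := by
      rw [← Finset.sum_add_distrib]
      exact Finset.sum_congr rfl fun i _ => by rw [map_add, polyFun_add, add_smul]
    rw [h]
    have : polyFun (p + q) = fun y => polyFun p y + polyFun q y := funext fun y => polyFun_add p q y
    rw [this]
    exact hp.add hq
  | mul_X p i hp =>
    have hfun : polyFun (p * X i) = fun y => polyFun p y * (EuclideanSpace.proj (𝕜 := ℝ) i : _ →L[ℝ] ℝ) y := by
      funext y
      rw [polyFun_mul, polyFun_X]
      rfl
    rw [hfun]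
    have hmul := hp.mul (EuclideanSpace.proj (𝕜 := ℝ) i).hasFDerivAt
    refine hmul.congr_fderiv ?_
    -- `Σ_j polyFun(∂ⱼ(p·Xᵢ)) • projⱼ = polyFun p • projᵢ + xᵢ • Σ_j polyFun(∂ⱼp) • projⱼ`, checked on vectors
    have hcoef : ∀ j, polyFun (pderiv j (p * X i)) x =
        polyFun (pderiv j p) x * x i + polyFun p x * (if i = j then 1 else 0) := by
      intro j
      rw [pderiv_mul, pderiv_X, Pi.single_apply, polyFun_add, polyFun_mul, polyFun_mul, polyFun_X]
      split_ifs <;> simp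
    ext v
    have hx : (EuclideanSpace.proj (𝕜 := ℝ) i : EuclideanSpace ℝ ι →L[ℝ] ℝ) x = x i := rfl
    simp only [hx, add_apply, FunLike.coe_sum, Finset.sum_apply, FunLike.coe_smul, Pi.smul_apply,
      smul_eq_mul, hcoef]
    have hp1 : ∀ j, (EuclideanSpace.proj (𝕜 := ℝ) j : EuclideanSpace ℝ ι →L[ℝ] ℝ) v = v j := fun j => rfl
    simp only [hp1, add_mul, Finset.sum_add_distrib, mul_ite, mul_one, mul_zero, ite_mul, zero_mul,
      Finset.sum_ite_eq, Finset.mem_univ, if_true, Finset.mul_sum]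
    rw [add_comm]
    congr 1
    exact Finset.sum_congr rfl fun j _ => by ring

/-- **(P1′)** `fderiv` form of (P1). -/
theorem fderiv_polyFun (P : MvPolynomial ι ℝ) (x : EuclideanSpace ℝ ι) :
    fderiv ℝ (polyFun P) x = ∑ i, polyFun (pderiv i P) x • EuclideanSpace.proj (𝕜 := ℝ) i :=
  (hasFDerivAt_polyFun P x).fderiv

/-- **(P1″)** `D(polyFun P)(x) v = Σ_i polyFun (∂ᵢP)(x) · vᵢ`. -/
theorem fderiv_polyFun_apply (P : MvPolynomial ι ℝ) (x v : EuclideanSpace ℝ ι) :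
    fderiv ℝ (polyFun P) x v = ∑ i, polyFun (pderiv i P) x * v i := by
  rw [fderiv_polyFun, FunLike.coe_sum, Finset.sum_apply]
  exact Finset.sum_congr rfl fun i _ => by simp

/-- Polynomial functions are differentiable. -/
theorem differentiable_polyFun (P : MvPolynomial ι ℝ) : Differentiable ℝ (polyFun P) :=
  fun x => (hasFDerivAt_polyFun P x).differentiableAt

omit [DecidableEq ι] in
/-- **(P3) Polynomial functions are `C^n`** for every `n`. -/
theorem contDiff_polyFun (P : MvPolynomial ι ℝ) {n : WithTop ℕ∞} : ContDiff ℝ n (polyFun P) := by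
  induction P using MvPolynomial.induction_on with
  | C a =>
    have : polyFun (C a : MvPolynomial ι ℝ) = fun _ => a := funext fun y => polyFun_C a y
    rw [this]
    exact contDiff_const
  | add p q hp hq =>
    have : polyFun (p + q) = fun y => polyFun p y + polyFun q y := funext fun y => polyFun_add p q y
    rw [this]
    exact hp.add hq
  | mul_X p i hp =>
    have hfun : polyFun (p * X i) = fun y => polyFun p y * (EuclideanSpace.proj (𝕜 := ℝ) i : _ →L[ℝ] ℝ) y := by
      funext y
      rw [polyFun_mul, polyFun_X]
      rfl
    rw [hfun]
    exact hp.mul (EuclideanSpace.proj (𝕜 := ℝ) i).contDiff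

omit [DecidableEq ι] in
/-- Polynomial functions are `C^n` at every point. -/
theorem contDiffAt_polyFun (P : MvPolynomial ι ℝ) {n : WithTop ℕ∞} (x : EuclideanSpace ℝ ι) :
    ContDiffAt ℝ n (polyFun P) x :=
  (contDiff_polyFun P).contDiffAt

/-- **(P2) The gradient of a polynomial function, paired**: `⟪∇(polyFun P)(x), v⟫ = Σ_i polyFun(∂ᵢP)(x)·vᵢ`. -/
theorem inner_gradient_polyFun (P : MvPolynomial ι ℝ) (x v : EuclideanSpace ℝ ι) :
    ⟪gradient (polyFun P) x, v⟫ = ∑ i, polyFun (pderiv i P) x * v i := by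
  rw [gradient, InnerProductSpace.toDual_symm_apply, fderiv_polyFun_apply]

/-- **(P2′) The gradient of a polynomial function, coordinatewise**: `∇(polyFun P)(x)ᵢ = polyFun(∂ᵢP)(x)`. -/
theorem gradient_polyFun_apply (P : MvPolynomial ι ℝ) (x : EuclideanSpace ℝ ι) (i : ι) :
    gradient (polyFun P) x i = polyFun (pderiv i P) x := by
  have h := inner_gradient_polyFun P x (EuclideanSpace.single i 1)
  rw [EuclideanSpace.inner_single_right] at h
  simp only [one_mul, conj_trivial] at h
  rw [h]
  simp [PiLp.single_apply, Finset.sum_ite_eq']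

/-- **(P2″)** `⟪x, ∇(polyFun P)(x)⟫ = polyFun(Σ_i Xᵢ·∂ᵢP)(x)`. -/
theorem inner_self_gradient_polyFun (P : MvPolynomial ι ℝ) (x : EuclideanSpace ℝ ι) :
    ⟪x, gradient (polyFun P) x⟫ = polyFun (∑ i, X i * pderiv i P) x := by
  rw [real_inner_comm, inner_gradient_polyFun, polyFun_sum]
  exact Finset.sum_congr rfl fun i _ => by rw [polyFun_mul, polyFun_X, mul_comm]

/-- **(P5) The EULER IDENTITY for homogeneous polynomials**: `⟪x, ∇h(x)⟫ = l·h(x)` for `h = polyFun P`,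
`P` homogeneous of degree `l` (Mathlib's `MvPolynomial.IsHomogeneous.sum_X_mul_pderiv`). -/
theorem inner_self_gradient_polyFun_of_isHomogeneous {P : MvPolynomial ι ℝ} {l : ℕ} (hP : P.IsHomogeneous l)
    (x : EuclideanSpace ℝ ι) : ⟪x, gradient (polyFun P) x⟫ = l * polyFun P x := by
  rw [inner_self_gradient_polyFun, hP.sum_X_mul_pderiv, polyFun_nsmul]

/-- **The second derivative of a polynomial function**:
`D²(polyFun P)(x)(v,w) = Σ_i Σ_j polyFun(∂ⱼ∂ᵢP)(x)·vⱼ·wᵢ`. -/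
theorem fderiv_fderiv_polyFun_apply (P : MvPolynomial ι ℝ) (x v w : EuclideanSpace ℝ ι) :
    fderiv ℝ (fderiv ℝ (polyFun P)) x v w = ∑ i, (∑ j, polyFun (pderiv j (pderiv i P)) x * v j) * w i := by
  have hfd : fderiv ℝ (polyFun P) = fun y => ∑ i, polyFun (pderiv i P) y • EuclideanSpace.proj (𝕜 := ℝ) i :=
    funext fun y => fderiv_polyFun P y
  have hD : HasFDerivAt (fun y => ∑ i, polyFun (pderiv i P) y • (EuclideanSpace.proj (𝕜 := ℝ) i : _ →L[ℝ] ℝ))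
      (∑ i, (∑ j, polyFun (pderiv j (pderiv i P)) x • EuclideanSpace.proj (𝕜 := ℝ) j).smulRight
        (EuclideanSpace.proj (𝕜 := ℝ) i : EuclideanSpace ℝ ι →L[ℝ] ℝ)) x := by
    refine HasFDerivAt.fun_sum fun i _ => ?_
    exact (hasFDerivAt_polyFun (pderiv i P) x).smul_const
      (EuclideanSpace.proj (𝕜 := ℝ) i : EuclideanSpace ℝ ι →L[ℝ] ℝ)
  rw [hfd, hD.fderiv, FunLike.coe_sum, Finset.sum_apply, FunLike.coe_sum, Finset.sum_apply]
  refine Finset.sum_congr rfl fun i _ => ?_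
  have hp1 : ∀ (j : ι) (u : EuclideanSpace ℝ ι),
      (EuclideanSpace.proj (𝕜 := ℝ) j : EuclideanSpace ℝ ι →L[ℝ] ℝ) u = u j := fun j u => rfl
  simp only [ContinuousLinearMap.smulRight_apply, FunLike.coe_sum, Finset.sum_apply, FunLike.coe_smul,
    Pi.smul_apply, smul_eq_mul, hp1]

/-- **(P4) The Laplacian of a polynomial function**: `Δ(polyFun P)(x) = polyFun(Σ_i ∂ᵢ∂ᵢP)(x)`. -/
theorem laplacian_polyFun (P : MvPolynomial ι ℝ) (x : EuclideanSpace ℝ ι) :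
    Δ (polyFun P) x = polyFun (∑ i, pderiv i (pderiv i P)) x := by
  rw [laplacian_eq_iteratedFDeriv_orthonormalBasis (polyFun P) (EuclideanSpace.basisFun ι ℝ), polyFun_sum]
  refine Finset.sum_congr rfl fun k _ => ?_
  rw [iteratedFDeriv_two_apply]
  simp only [Matrix.cons_val_zero, Matrix.cons_val_one]
  rw [fderiv_fderiv_polyFun_apply]
  simp [PiLp.single_apply, Finset.sum_ite_eq']

/-- **(P4′) Harmonicity from algebra**: if `Σ_i ∂ᵢ∂ᵢP = 0` in `MvPolynomial ι ℝ` then `Δ(polyFun P) ≡ 0`. -/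
theorem laplacian_polyFun_eq_zero {P : MvPolynomial ι ℝ} (h : ∑ i, pderiv i (pderiv i P) = 0)
    (x : EuclideanSpace ℝ ι) : Δ (polyFun P) x = 0 := by
  rw [laplacian_polyFun, h, polyFun_zero]

end

end HarmonicShell

end Summit.NavierStokesRegularity.NavierStokesRegularity.Theorems.StrainDoors
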